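import Summits.BirchSwinnertonDyer.BirchSwinnertonDyer.Theses.InertBadSignedBranches
import HarnessLib

/-!
# Route `InertBadSignedBranches` (rung K8, rev 11) — the by-name glue item `SignedReadingFactsOfParts`
# (stmt-BirchSwinnertonDyer-19520) CLOSED

Planner bsd-cm-plan g16 (D95) split the support item `SignedReadingFacts` (19502: Kitajima–Otsuki 2018
Main Thm 1.3 at `η` ∧ Kobayashi 2003 Thm 7.4 at `η`, both named Literature facts) into its two by-name parts
(`PublishedInputKO13`, dedup'd with bsd-potss, and `PublishedInputKob74`) plus this glue: parts ⟹ parent.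
The parts are the parent's conjuncts; the proof is the anonymous constructor (planner-checked draft
HOME/bsd-cm-plan/g16/repair/K8/ClosingDrafts.lean; filed by hand k8i-c2 g4). Nothing mathematical is
asserted: an implication between the route's own items. [cite: KitajimaOtsuki2018, Main Thm. 1.3 (arXiv:1607.03612 p. 3)]
[cite: Kobayashi2003, Thm. 7.4 (p. 13)]
-/

set_option linter.dupNamespace false

namespace Summit.BirchSwinnertonDyer.BirchSwinnertonDyer.Theorems

open Summit.BirchSwinnertonDyer.BirchSwinnertonDyer.Theses.InertBadSignedBranches in
/-- **`SignedReadingFactsOfParts` holds** (stmt-BirchSwinnertonDyer-19520): `SignedReadingFacts` from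
its two by-name parts, Kitajima–Otsuki Main Thm 1.3 at `η` and Kobayashi Thm 7.4 at `η`.
[cite: KitajimaOtsuki2018, Main Thm. 1.3 (arXiv:1607.03612 p. 3)] [cite: Kobayashi2003, Thm. 7.4 (p. 13)] -/
theorem inertBadSignedBranches_signedReadingFactsOfParts_proof : SignedReadingFactsOfParts :=
  fun h₁ h₂ => ⟨h₁, h₂⟩

end Summit.BirchSwinnertonDyer.BirchSwinnertonDyer.Theorems
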